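import Mathlib
import Summits.KontsevichZagierPeriods.KontsevichZagierPeriods.Theorems.InverseLandauTateFamilyKernelTateAnchor
import Summits.KontsevichZagierPeriods.KontsevichZagierPeriods.Theorems.InverseLandauTateFamilyKernelStubEulerDivergence

/-!
# Crux `TateFamilyKernel` (stmt-KontsevichZagierPeriods-9130), line `Sketch`:
# stub `stub_eulerAnchor` (wave 12, Euler sector, step (A))

The EULER ANCHOR of the Euler sector of the lead's skeleton of the crux
`Summit.KontsevichZagierPeriods.KontsevichZagierPeriods.Theses.InverseLandau.TateFamilyKernel`:
a Tate-anchored Newton–Leibniz move in the REPARAMETRISED parameter `t`, `ϖ = ϖ₀ t^d`.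

Data: a pencil `Q = 1 − ϖT`, `T ∈ ℚ[z₁,z₂]`, a `ϖ`-free numerator `P₀ ∈ ℚ[z₁,z₂]`, an exponent
`d ≥ 1`, a weight `λ = w + a + b ≥ 1` and a real-algebraic `ϖ₀` with `1 − ϖ₀ t^d T(z) ≠ 0` on the
closed cube `[0,1]³ ∋ (z, t)`. Variables of the 4-variable data: `X 0, X 1 = z`, `X 2 = t`,
`X 3 ↦ ϖ₀` (evaluation at `Fin.snoc x ϖ₀`, `x ∈ [0,1]³`); of the 3-variable fibre data: `X 0, X 1 = z`,
`X 2 ↦ ϖ₀`.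

The primitive `H(z,t) := t^λ · P₀(z) / (1 − ϖ₀ t^d T(z))` is analytic near `[0,1]³` and
`ℚ`-semialgebraic on it, and

* `∂_t H = t^{λ−1} · (λ·P₀·Q + d·ϖ·P₀·T)/Q²` at `ϖ = ϖ₀ t^d` — the integrand of the tame cube `r`;
* `H(z,1) = P₀(z)/(1 − ϖ₀T(z))` — the integrand of the tame fibre `Φ`; `H(z,0) = 0` since `λ ≥ 1`.

Hence `[r] − [Φ]` is ONE cubical Stokes generator along the last coordinate
(`KZ.mem_cubicalStokesGens`, Ayoub's relation `∂f/∂z₃ − f|_{z₃=1} + f|_{z₃=0}` with vanishing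
`z₃ = 0` face; `KZ.cubicalStokesGens_subset_relations`), and `[Φ] − [r] ∈ KZ.relations`.
This mirrors `tateAnchor` (the linear homotopy `ϖ = ϖ₀ s`) of
`InverseLandauTateFamilyKernelTateAnchor.lean`, whose analyticity / semialgebraicity lemmas for
sliced rational functions are reused; the one-variable calculus is the scalar lemma
`EulerAnchor.hasDerivAt_weight`.

References: Kontsevich–Zagier 2001, §1.2 rule (3); Ayoub 2014, Def. 10. Mathlib plus landed sibling
files; no named fact, no new definition. Helpers live in the sub-namespace `EulerAnchor`.
-/

noncomputable section

open MeasureTheory Set MvPolynomial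
open Literature.NumberTheory.Transcendental

namespace Summit.KontsevichZagierPeriods.InverseLandau.TateFamilyKernel.Descent

namespace EulerAnchor

/-- Coordinate `2` (the reparametrised parameter `t`) of the point `(x, s, ϖ₀) ∈ ℝ⁴`. [folklore] -/
theorem snoc_snoc_apply_two (x : Fin 2 → ℝ) (s ϖ₀ : ℝ) :
    (Fin.snoc (Fin.snoc x s : Fin (2 + 1) → ℝ) ϖ₀ : Fin (3 + 1) → ℝ) 2 = s := rfl

/-- Coordinate `3` (the slot of `ϖ₀`) of the point `(x, s, ϖ₀) ∈ ℝ⁴`. [folklore] -/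
theorem snoc_snoc_apply_three (x : Fin 2 → ℝ) (s ϖ₀ : ℝ) :
    (Fin.snoc (Fin.snoc x s : Fin (2 + 1) → ℝ) ϖ₀ : Fin (3 + 1) → ℝ) 3 = ϖ₀ := rfl

/-- The first two coordinates of `(x, s, ϖ₀) ∈ ℝ⁴` are `x`. [folklore] -/
theorem snoc_snoc_comp_castLE (x : Fin 2 → ℝ) (s ϖ₀ : ℝ) :
    (Fin.snoc (Fin.snoc x s : Fin (2 + 1) → ℝ) ϖ₀ : Fin (3 + 1) → ℝ) ∘
        Fin.castLE (show 2 ≤ 4 by norm_num) = x := by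
  ext i
  fin_cases i <;> rfl

/-- Evaluation of the 4-variable lift of a `z`-polynomial at `(x, s, ϖ₀)`: `(rename ι R)(x,s,ϖ₀) = R(x)`.
[folklore] -/
theorem aeval_snoc_snoc_rename (R : MvPolynomial (Fin 2) ℚ) (x : Fin 2 → ℝ) (s ϖ₀ : ℝ) :
    aeval (Fin.snoc (Fin.snoc x s : Fin (2 + 1) → ℝ) ϖ₀ : Fin (3 + 1) → ℝ)
        (rename (Fin.castLE (show 2 ≤ 4 by norm_num)) R) = aeval x R := by
  rw [aeval_rename, snoc_snoc_comp_castLE]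

/-- **The one-variable calculus of the Euler anchor.** For `λ, d ≥ 1` and `1 − ϖ₀ t^d τ ≠ 0`:
`d/ds [s^λ p / (1 − ϖ₀ s^d τ)]|_{s=t} = t^{λ−1}·(λ p (1 − ϖ₀ t^d τ) + d ϖ₀ t^d p τ)/(1 − ϖ₀ t^d τ)²`
(quotient rule; `t^λ · t^{d−1} = t^{λ−1} · t^d`). [folklore] -/
theorem hasDerivAt_weight {l d : ℕ} (hd : 0 < d) (hl : 1 ≤ l) (p τ ϖ₀ t : ℝ)
    (hq : 1 - ϖ₀ * t ^ d * τ ≠ 0) :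
    HasDerivAt (fun s : ℝ => s ^ l * p / (1 - ϖ₀ * s ^ d * τ))
      (t ^ (l - 1) * ((l : ℝ) * p * (1 - ϖ₀ * t ^ d * τ) + (d : ℝ) * ϖ₀ * t ^ d * p * τ) /
        (1 - ϖ₀ * t ^ d * τ) ^ 2) t := by
  obtain ⟨k, rfl⟩ : ∃ k, l = k + 1 := ⟨l - 1, (Nat.sub_add_cancel hl).symm⟩
  obtain ⟨e, rfl⟩ : ∃ e, d = e + 1 := ⟨d - 1, (Nat.sub_add_cancel hd).symm⟩
  have hnum : HasDerivAt (fun s : ℝ => s ^ (k + 1) * p) (((k + 1 : ℕ) : ℝ) * t ^ k * p) t := by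
    simpa using (hasDerivAt_pow (k + 1) t).mul_const p
  have hden : HasDerivAt (fun s : ℝ => 1 - ϖ₀ * s ^ (e + 1) * τ)
      (-(ϖ₀ * (((e + 1 : ℕ) : ℝ) * t ^ e) * τ)) t := by
    simpa using (((hasDerivAt_pow (e + 1) t).const_mul ϖ₀).mul_const τ).const_sub 1
  refine (hnum.div hden hq).congr_deriv ?_
  rw [Nat.add_sub_cancel]
  congr 1
  push_cast
  ring

end EulerAnchor

/-- STUB `stub_eulerAnchor` (wave 12 — (A) EULER ANCHOR: Tate-anchored Newton–Leibniz in the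
reparametrised parameter `t`, `ϖ = ϖ₀t^d`). For tame cubes `Φ` (the fibre `P₀/(1−ϖ₀T)`) and `r`
(integrand `t^{λ−1}·(λP₀Q + dϖP₀T)/Q²` at `ϖ = ϖ₀t^d`, `Q = 1 − ϖT`): `[Φ] − [r] ∈ KZ.relations` —
the Ayoub element in direction `t` of `H = t^λ P₀/(1 − X3·X2^d·T)`, whose `t = 1` face is `Φ`'s
integrand and whose `t = 0` face vanishes (`λ ≥ 1`).
[cite: KontsevichZagier2001, §1.2] -/
theorem stub_eulerAnchor (a b d w : ℕ) (hd : 0 < d) (hl : 1 ≤ w + a + b) (T P₀ : MvPolynomial (Fin 2) ℚ)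
    (ϖ₀ : ℝ) (halg : IsAlgebraic ℚ ϖ₀)
    (hadm : ∀ x ∈ KZ.cube 3, aeval (Fin.snoc x ϖ₀ : Fin (3 + 1) → ℝ)
      (1 - X 3 * X 2 ^ d * rename (Fin.castLE (show 2 ≤ 4 by norm_num)) T) ≠ 0)
    (Φ : KZ.IntegralRep 2) (hΦ : Φ.IsTameCube)
    (hΦi : ∀ z ∈ KZ.cube 2, Φ.integrand z =
      aeval (Fin.snoc z ϖ₀ : Fin (2 + 1) → ℝ) (rename Fin.castSucc P₀) /
        aeval (Fin.snoc z ϖ₀ : Fin (2 + 1) → ℝ) (1 - X 2 * rename Fin.castSucc T))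
    (r : KZ.IntegralRep 3) (hr : r.IsTameCube)
    (hri : ∀ x ∈ KZ.cube 3, r.integrand x =
      aeval (Fin.snoc x ϖ₀ : Fin (3 + 1) → ℝ)
          (X 2 ^ (w + a + b - 1) *
            (C ((w + a + b : ℕ) : ℚ) * rename (Fin.castLE (show 2 ≤ 4 by norm_num)) P₀ *
                (1 - X 3 * X 2 ^ d * rename (Fin.castLE (show 2 ≤ 4 by norm_num)) T) +
              C ((d : ℕ) : ℚ) * X 3 * X 2 ^ d * rename (Fin.castLE (show 2 ≤ 4 by norm_num)) P₀ *
                rename (Fin.castLE (show 2 ≤ 4 by norm_num)) T)) /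
        aeval (Fin.snoc x ϖ₀ : Fin (3 + 1) → ℝ)
          ((1 - X 3 * X 2 ^ d * rename (Fin.castLE (show 2 ≤ 4 by norm_num)) T) ^ 2)) :
    KZ.of Φ - KZ.of r ∈ KZ.relations := by
  -- the 4-variable data `Q₄ = 1 − X₃ X₂^d T`, `N₄ = X₂^λ P₀` and the primitive `H = N₄/Q₄` sliced at `ϖ₀`
  set Q₄ : MvPolynomial (Fin (3 + 1)) ℚ :=
    1 - X 3 * X 2 ^ d * rename (Fin.castLE (show 2 ≤ 4 by norm_num)) T with hQ₄
  set N₄ : MvPolynomial (Fin (3 + 1)) ℚ :=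
    X 2 ^ (w + a + b) * rename (Fin.castLE (show 2 ≤ 4 by norm_num)) P₀ with hN₄
  set H : (Fin 3 → ℝ) → ℝ := fun y =>
    aeval (Fin.snoc y ϖ₀ : Fin (3 + 1) → ℝ) N₄ / aeval (Fin.snoc y ϖ₀ : Fin (3 + 1) → ℝ) Q₄ with hH
  have hHa : AnalyticOnNhd ℝ H (KZ.cube 3) := fun y hy =>
    analyticAt_aeval_div_aeval_snoc ϖ₀ N₄ Q₄ (hadm y hy)
  have hHs : IsSemialgebraicFunOn ℚ (KZ.cube 3) H :=
    isSemialgebraicFunOn_aeval_div_aeval_comp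
      (isSemialgebraicMapOn_snoc_const KZ.isSemialgebraic_cube halg) N₄ Q₄ hadm
  -- the primitive along the fibres of the last coordinate, in scalar form
  have hHx : ∀ (x : Fin 2 → ℝ) (s : ℝ), H (Fin.snoc x s) =
      s ^ (w + a + b) * aeval x P₀ / (1 - ϖ₀ * s ^ d * aeval x T) := by
    intro x s
    simp only [hH, hN₄, hQ₄, map_sub, map_mul, map_pow, map_one, aeval_X,
      EulerAnchor.snoc_snoc_apply_two, EulerAnchor.snoc_snoc_apply_three,
      EulerAnchor.aeval_snoc_snoc_rename]
  -- one cubical Stokes move along `t`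
  have hmove : KZ.of r - KZ.of Φ ∈ KZ.relations := by
    refine KZ.cubicalStokesGens_subset_relations (KZ.mem_cubicalStokesGens hr hΦ hHa hHs ?_ ?_)
    · -- `∂_t H = r.integrand`
      intro x hx t ht
      have hxt : (Fin.snoc x t : Fin (2 + 1) → ℝ) ∈ KZ.cube (2 + 1) :=
        KZ.snoc_mem_cube_iff.2 ⟨hx, ht.1, ht.2⟩
      have hq : 1 - ϖ₀ * t ^ d * aeval x T ≠ 0 := by
        have h := hadm _ hxt
        simpa only [hQ₄, map_sub, map_mul, map_pow, map_one, aeval_X,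
          EulerAnchor.snoc_snoc_apply_two, EulerAnchor.snoc_snoc_apply_three,
          EulerAnchor.aeval_snoc_snoc_rename] using h
      have hfun : (fun s : ℝ => H (Fin.snoc x s)) =
          fun s : ℝ => s ^ (w + a + b) * aeval x P₀ / (1 - ϖ₀ * s ^ d * aeval x T) :=
        funext fun s => hHx x s
      rw [hri _ hxt, hfun]
      simp only [hQ₄, map_sub, map_mul, map_add, map_pow, map_one, aeval_X, map_natCast,
        EulerAnchor.snoc_snoc_apply_two, EulerAnchor.snoc_snoc_apply_three,
        EulerAnchor.aeval_snoc_snoc_rename]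
      exact EulerAnchor.hasDerivAt_weight hd hl (aeval x P₀) (aeval x T) ϖ₀ t hq
    · -- the faces: `H(x,1) = Φ.integrand x`, `H(x,0) = 0`
      intro x hx
      have hl0 : w + a + b ≠ 0 := Nat.one_le_iff_ne_zero.mp hl
      rw [hΦi x hx, hHx, hHx]
      simp only [map_sub, map_mul, map_one, aeval_X, EulerDivergence.snoc_apply_two,
        LinMoments.aeval_snoc_rename_castSucc, one_pow, mul_one, one_mul, zero_pow hl0, zero_mul,
        zero_div, sub_zero]
  -- `[Φ] − [r] = −([r] − [Φ])`
  have h := KZ.relations.neg_mem hmove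
  rwa [neg_sub] at h

end Summit.KontsevichZagierPeriods.InverseLandau.TateFamilyKernel.Descent
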